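import Mathlib
import Literature.MathematicalPhysics.MHD.SolovevFluxSurfacePeeling
import Summits.Ventures.FusionMHD.Models.SolovevPCFResistiveIndex
import HarnessLib

/-!
# Ventures/FusionMHD — Models/SolovevPCFPeeling.lean: on the two F1.a analytic equilibria of record, the printed
# toroidal PEELING criterion FAILS on every flux surface for every F > 0, and the signs `V″ > 0`, `Φ″ > 0`
# (instance glue; no numerics)

HONEST FRAMING (LADDER-GRIDFUSION three columns). CERTIFIED (kernel): for MODEL M = the analytic
Pataki–Cerfon–Freidberg Solov'ev instances of `Models/SolovevPCF.lean` (ideal MHD, fixed boundary, finite edge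
current density and pressure gradient), every flux surface `0 < r < R_a/2` — in particular the plasma edge
`r = ε/R_a` — VIOLATES the peeling criterion `Λ_p < 0` AS PRINTED (Zheng 2015 §2.5 (2.100)–(2.101), typed by
gridfusion-lit-3 in `PeelingCriterion.lean`; Lortz 1975 / Wesson 1978), for every value of the free constant
`F = RB_φ > 0`: a NEGATIVE criterion row.  MODELLED: ideal localized external (peeling) modes, vacuum term
dropped at O(ε²), no wall, no separatrix, analytic equilibrium — nothing about a device.  Also exported: the
signs `V″ > 0` (volume convex in the flux label) and `Φ″ > 0` (positive shear), which discharge the `Φ″ ≠ 0`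
hypothesis of `mercierCriterion_of_resistiveIndex_neg` (F1.DR).  Everything is a one-line instance of
`Literature/MathematicalPhysics/MHD/SolovevFluxSurfacePeeling.lean`. Typer/prover: gridfusion-model-5 (g4), 2026-08-27.
Citations: Zheng 2015 §2.5 [Zheng2015]; Jardin 2010 (5.29)/(5.31) [Jardin2010].
-/

noncomputable section

namespace Summit.Ventures.FusionMHD.Models.SolovevPCF

open Literature.MathematicalPhysics.MHD Literature.MathematicalPhysics.MHD.GradShafranov
  Literature.MathematicalPhysics.MHD.Solovev Literature.MathematicalPhysics.MHD.Mercier.FluxForm _root_.Real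

namespace IterLike

section surface

variable {F r : ℝ} (hF : 0 < F) (hr : 0 < r) (h2r : 2 * r < Ra)
include hF hr h2r

/-- `V″ > 0` on every surface of the ITER-like instance. -/
theorem ggjData_V''_pos : 0 < (ggjData F r).V'' :=
  lcGGJData_V''_pos Ra_pos kappa0_pos hF (q0_pos hF) hr h2r _ _

/-- `Φ″ > 0` on every surface of the ITER-like instance (positive shear). -/
theorem ggjData_Φ''_pos : 0 < (ggjData F r).Φ'' :=
  lcGGJData_Φ''_pos Ra_pos kappa0_pos hF (q0_pos hF) hr h2r hF _

/-- **The peeling criterion FAILS** on every surface of the ITER-like instance, every `F > 0`. -/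
theorem not_peelingCriterion_ggjData : ¬ (ggjData F r).PeelingCriterion :=
  not_peelingCriterion_lcGGJData Ra_pos kappa0_pos hF (q0_pos hF) hr h2r hF _

/-- F1.DR without the shear hypothesis: `D_R < 0 ⇒` Mercier on the surface (`Φ″ ≠ 0` discharged). -/
theorem mercierCriterion_of_resistiveIndex_neg' (h : resistiveIndex F r < 0) : (ggjData F r).MercierCriterion :=
  mercierCriterion_of_resistiveIndex_neg hF hr h2r (ggjData_Φ''_pos hF hr h2r).ne' h

end surface

/-- The edge surface `r = ε/R_a` (plasma boundary `Ψ = 0`) violates the peeling criterion, every `F > 0`. -/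
theorem not_peelingCriterion_edge {F : ℝ} (hF : 0 < F) : ¬ (ggjData F (ε / Ra)).PeelingCriterion :=
  not_peelingCriterion_ggjData hF edge_minorRadius.1 edge_minorRadius.2

end IterLike

namespace NstxLike

section surface

variable {F r : ℝ} (hF : 0 < F) (hr : 0 < r) (h2r : 2 * r < Ra)
include hF hr h2r

/-- `V″ > 0` on every surface of the NSTX-like instance. -/
theorem ggjData_V''_pos : 0 < (ggjData F r).V'' :=
  lcGGJData_V''_pos Ra_pos kappa0_pos hF (q0_pos hF) hr h2r _ _

/-- `Φ″ > 0` on every surface of the NSTX-like instance (positive shear). -/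
theorem ggjData_Φ''_pos : 0 < (ggjData F r).Φ'' :=
  lcGGJData_Φ''_pos Ra_pos kappa0_pos hF (q0_pos hF) hr h2r hF _

/-- **The peeling criterion FAILS** on every surface of the NSTX-like instance, every `F > 0`. -/
theorem not_peelingCriterion_ggjData : ¬ (ggjData F r).PeelingCriterion :=
  not_peelingCriterion_lcGGJData Ra_pos kappa0_pos hF (q0_pos hF) hr h2r hF _

/-- F1.DR without the shear hypothesis: `D_R < 0 ⇒` Mercier on the surface (`Φ″ ≠ 0` discharged). -/
theorem mercierCriterion_of_resistiveIndex_neg' (h : resistiveIndex F r < 0) : (ggjData F r).MercierCriterion :=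
  mercierCriterion_of_resistiveIndex_neg hF hr h2r (ggjData_Φ''_pos hF hr h2r).ne' h

end surface

/-- The edge surface `r = ε/R_a` violates the peeling criterion, every `F > 0`. -/
theorem not_peelingCriterion_edge {F : ℝ} (hF : 0 < F) : ¬ (ggjData F (ε / Ra)).PeelingCriterion :=
  not_peelingCriterion_ggjData hF edge_minorRadius.1 edge_minorRadius.2

end NstxLike

end Summit.Ventures.FusionMHD.Models.SolovevPCF
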